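import Summits.Ventures.HodgeRepro2.T7SupportCompactRegularPoint
import Summits.Ventures.HodgeRepro2.T7SupportDenseRegularPoint

/-!
# The compact place: every dense subset of `U(2)` meets the regular non-vanishing locus (support, seat p1)

The `U(2)` twin of the model half of `T7SupportDenseRegularPoint`: the invariant `κ` of
`T7SupportCompactRegularPoint` is continuous on `U(2)` (`continuous_kappa`), the regular non-vanishing locus
`{κ ≠ 1} ∩ {coeff τ x x (· h) ≠ 0}` is open (`isOpen_regularNonvanishing`) and non-empty
(`T7SupportCompactRegularPoint.exists_regular_coeff_ne_zero`), so every dense `S ⊆ U(2)` contains a regular `γ₀`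
with `⟪x, τ(γ₀ h) x⟫ ≠ 0` (`exists_mem_dense_regular_coeff_ne_zero`); and the non-regular locus `{κ = 1} = K h⁻¹`
is closed with empty interior (`interior_kappa_eq_one_eq_empty`: the perturbation `γ h r(t) h⁻¹ → γ` is regular for
`0 < t < π`), so for ANY continuous `F` on `U(2)` not identically zero every dense `S` has a regular `γ₀` with
`F γ₀ ≠ 0` (`exists_mem_dense_ne_zero_kappa_ne_one`). With `S` = the rational points (weak approximation — printed,
in words) this is the compact-place half of the choice of `γ₀` in the line's §2, in the model.

Explicit model only; nothing about the adelic group or any period.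
Blind lane: Mathlib + the HodgeRepro2 prefix only; no sorry; axioms ⊆ {propext, Classical.choice, Quot.sound}.
-/

namespace Summit.Ventures.HodgeRepro2.T7SupportCompactDensePoint

open Matrix Filter Topology
open scoped InnerProductSpace
open T7SupportTwoTorusInvariant T7SupportWeightTorusOrbital T7SupportWeightTorusContinuous
  T7SupportCompactRegularPoint

/-- the entries of `U(2)` are continuous -/
theorem continuous_matU_apply (i j : Fin 2) : Continuous fun g : U2 => matU g i j :=
  (continuous_apply j).comp ((continuous_apply i).comp continuous_subtype_val)

/-- **`κ` is continuous on `U(2)`** -/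
theorem continuous_kappa (h : U2) :
    Continuous fun γ : U2 => kappa (starRingEnd ℂ) dd2 (colBasis h) (matU γ) := by
  have e : (fun γ : U2 => kappa (starRingEnd ℂ) dd2 (colBasis h) (matU γ)) =
      fun γ => ((Complex.normSq (matU (γ * h) 0 0) : ℝ) : ℂ) := funext fun γ => kappa_eq_normSq γ h
  rw [e]
  exact Complex.continuous_ofReal.comp (Complex.continuous_normSq.comp
    ((continuous_matU_apply 0 0).comp (continuous_id.mul continuous_const)))

/-- the non-regular locus is closed -/
theorem isClosed_kappa_eq_one (h : U2) :
    IsClosed {γ : U2 | kappa (starRingEnd ℂ) dd2 (colBasis h) (matU γ) = 1} :=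
  isClosed_eq (continuous_kappa h) continuous_const

/-! ### The regular non-vanishing locus -/

variable {V : Type*} [NormedAddCommGroup V] [InnerProductSpace ℂ V]

/-- the regular non-vanishing locus of the coefficient `γ ↦ ⟪x, τ(γ h) x⟫` -/
def regularNonvanishing (τ : U2 →* (V →ₗ[ℂ] V)) (x : V) (h : U2) : Set U2 :=
  {γ | kappa (starRingEnd ℂ) dd2 (colBasis h) (matU γ) ≠ 1 ∧ coeff τ x x (γ * h) ≠ 0}

/-- **the regular non-vanishing locus is open** -/
theorem isOpen_regularNonvanishing (τ : U2 →* (V →ₗ[ℂ] V)) (hc : IsStronglyContinuous τ) (x : V) (h : U2) :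
    IsOpen (regularNonvanishing τ x h) :=
  (isOpen_ne_fun (continuous_kappa h) continuous_const).inter
    (isOpen_ne_fun (continuous_coeff_mul_right hc x x h) continuous_const)

/-- **every dense subset of `U(2)` contains a regular `γ₀` with `⟪x, τ(γ₀ h) x⟫ ≠ 0`** -/
theorem exists_mem_dense_regular_coeff_ne_zero (τ : U2 →* (V →ₗ[ℂ] V)) (hc : IsStronglyContinuous τ) (x : V)
    (hx : x ≠ 0) (h : U2) {S : Set U2} (hS : Dense S) :
    ∃ γ₀ ∈ S, kappa (starRingEnd ℂ) dd2 (colBasis h) (matU γ₀) ≠ 1 ∧ coeff τ x x (γ₀ * h) ≠ 0 := by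
  obtain ⟨γ, hγ⟩ := exists_regular_coeff_ne_zero τ hc x hx h
  obtain ⟨s, hsS, hs⟩ := hS.exists_mem_open (isOpen_regularNonvanishing τ hc x h) ⟨γ, hγ⟩
  exact ⟨s, hsS, hs⟩

/-! ### The non-regular locus has empty interior -/

/-- the `(1, 0)`-entry of `g r(t)` is `c(g) cos t − d(g) sin t` -/
theorem matU_mul_rot_one_zero (g : U2) (t : ℝ) :
    matU (g * rot t) 1 0 = matU g 1 0 * (Real.cos t : ℂ) - matU g 1 1 * (Real.sin t : ℂ) := by
  show (matU g * rotM t) 1 0 = _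
  simp [rotM, Matrix.mul_apply, Fin.sum_univ_two, -Complex.ofReal_cos, -Complex.ofReal_sin]
  ring

/-- the entry `d(g)` of `g ∈ U(2)` with `c(g) = 0` is non-zero (`|d|² = 1` then) -/
theorem matU_one_one_ne_zero_of (g : U2) (hc : matU g 1 0 = 0) : matU g 1 1 ≠ 0 := by
  obtain ⟨-, e01, -, e11⟩ := entries g
  intro hd
  have ha : matU g 0 0 ≠ 0 := by
    intro ha
    have := normSq_add_normSq g
    rw [ha, hc] at this
    simp at this
  have hb : matU g 0 1 = 0 := by
    rw [hc] at e01
    simp only [map_zero, zero_mul, add_zero] at e01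
    rcases mul_eq_zero.1 e01 with h1 | h1
    · exact absurd ((map_eq_zero _).1 h1) ha
    · exact h1
  rw [hb, hd] at e11
  simp at e11

/-- the perturbation `γ h r(t) h⁻¹` of a non-regular `γ` is regular for `0 < t < π` -/
theorem kappa_perturb_ne_one (h γ : U2) (hγ : matU (γ * h) 1 0 = 0) {t : ℝ} (ht0 : 0 < t)
    (htπ : t < Real.pi) :
    kappa (starRingEnd ℂ) dd2 (colBasis h) (matU (γ * h * rot t * h⁻¹)) ≠ 1 := by
  intro h1
  have h2 : matU (γ * h * rot t) 1 0 = 0 := by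
    have := (kappa_eq_one_iff (γ * h * rot t * h⁻¹) h).1 h1
    rwa [inv_mul_cancel_right] at this
  rw [matU_mul_rot_one_zero, hγ, zero_mul, zero_sub, neg_eq_zero] at h2
  rcases mul_eq_zero.1 h2 with h3 | h3
  · exact matU_one_one_ne_zero_of _ hγ h3
  · exact (Real.sin_pos_of_pos_of_lt_pi ht0 htπ).ne' (Complex.ofReal_eq_zero.1 h3)

/-- `t ↦ γ h r(t) h⁻¹` tends to `γ` as `t → 0` -/
theorem tendsto_perturb (h γ : U2) : Tendsto (fun t : ℝ => γ * h * rot t * h⁻¹) (𝓝 0) (𝓝 γ) := by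
  have hc : Continuous fun t : ℝ => γ * h * rot t * h⁻¹ :=
    (continuous_const.mul continuous_rot).mul continuous_const
  have h0 : γ * h * rot 0 * h⁻¹ = γ := by rw [rot_zero, mul_one, mul_inv_cancel_right]
  simpa only [h0] using hc.tendsto 0

/-- **every point of `U(2)` is a limit of regular points** -/
theorem frequently_kappa_ne_one (h γ : U2) :
    ∃ᶠ γ' in 𝓝 γ, kappa (starRingEnd ℂ) dd2 (colBasis h) (matU γ') ≠ 1 := by
  by_cases hγ : matU (γ * h) 1 0 = 0
  · have htend : Tendsto (fun t : ℝ => γ * h * rot t * h⁻¹) (𝓝[>] 0) (𝓝 γ) :=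
      (tendsto_perturb h γ).mono_left nhdsWithin_le_nhds
    refine htend.frequently ?_
    have hI : ∀ᶠ t in 𝓝[>] (0 : ℝ), t ∈ Set.Ioo (0 : ℝ) Real.pi :=
      Filter.eventually_mem_set.2 (Ioo_mem_nhdsGT Real.pi_pos)
    exact (hI.mono fun t ht => kappa_perturb_ne_one h γ hγ ht.1 ht.2).frequently
  · have hne : kappa (starRingEnd ℂ) dd2 (colBasis h) (matU γ) ≠ 1 := by
      rw [Ne, kappa_eq_one_iff]
      exact hγ
    exact ((continuous_kappa h).continuousAt.eventually_ne hne).frequently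

/-- **the non-regular locus has empty interior** -/
theorem interior_kappa_eq_one_eq_empty (h : U2) :
    interior {γ : U2 | kappa (starRingEnd ℂ) dd2 (colBasis h) (matU γ) = 1} = ∅ := by
  have e : {γ : U2 | kappa (starRingEnd ℂ) dd2 (colBasis h) (matU γ) = 1} =
      {γ : U2 | kappa (starRingEnd ℂ) dd2 (colBasis h) (matU γ) - 1 = 0} := by
    ext γ
    simp only [Set.mem_setOf_eq, sub_eq_zero]
  rw [e]
  refine T7SupportDenseRegularPoint.interior_eq_empty_of_frequently fun γ => ?_
  exact (frequently_kappa_ne_one h γ).mono fun γ' hγ' => sub_ne_zero.2 hγ'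

/-- **any continuous function on `U(2)` not identically zero is non-zero at a regular point of every dense
subset** -/
theorem exists_mem_dense_ne_zero_kappa_ne_one (h : U2) {S : Set U2} (hS : Dense S) {F : U2 → ℂ}
    (hF : Continuous F) (hne : ∃ γ, F γ ≠ 0) :
    ∃ γ₀ ∈ S, F γ₀ ≠ 0 ∧ kappa (starRingEnd ℂ) dd2 (colBasis h) (matU γ₀) ≠ 1 := by
  obtain ⟨s, hsS, hs, hsZ⟩ := T7SupportDenseRegularPoint.exists_mem_dense_ne_zero_notMem hS hF hne
    (isClosed_kappa_eq_one h) (interior_kappa_eq_one_eq_empty h)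
  exact ⟨s, hsS, hs, hsZ⟩

end Summit.Ventures.HodgeRepro2.T7SupportCompactDensePoint
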